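import Summits.ResolutionOfSingularities.ResolutionOfSingularities.Theorems.PurelyInseparableDim4StepKit
import HarnessLib

/-!
# Purely inseparable fourfolds — STEP KIT (2/3): the translation `xᵢ ↦ xᵢ + bᵢ` on term lists
# (cell `res-dim4-pi`, WAVE3 row W3-2 «cert-1»)

[OURS · counted 0 · instrument] Nothing here is a statement about resolution of singularities.
Continues `PurelyInseparableDim4StepKit`: the tree's `PointBlowup.translate b = aeval (xᵢ ↦ xᵢ + C bᵢ)`
is re-implemented on term lists one variable at a time by the binomial theorem (`expandVar`, with the
shortcut `transVar i 0 = id`), composed over `List.finRange n` (`transAll`), and identified with the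
tree's translation through `MvPolynomial.algHom_ext` (`translate_evalT`).  Part 3
(`PurelyInseparableDim4StepKitState`) adds presented states, `CentreBlowup.step` and the cell's predicates.
bears_on: LADDER-RESOLUTION:D157-DOOR2 (res-dim4-pi · W3-2). Supports stmt-ResolutionOfSingularities-16155 (helper).
-/

set_option linter.dupNamespace false -- mandated namespace of this single-conjunct summit

noncomputable section

open MvPolynomial Finset

open scoped BigOperators

namespace Summit.ResolutionOfSingularities.ResolutionOfSingularities.Theorems.PIDim4

namespace StepKit

open Literature.AlgebraicGeometry.Resolution
open Literature.AlgebraicGeometry.Resolution.CentreBlowup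
open Literature.AlgebraicGeometry.Resolution.Hauser2010

variable {n : ℕ} {R : Type*} [CommRing R]

/-! ## §5 Translation -/

/-- Binomial expansion of ONE variable `xᵢ ↦ xᵢ + β` on term lists. [folklore] -/
def expandVar (i : Fin n) (β : R) (L : Terms n R) : Terms n R :=
  L.flatMap fun t => (List.range (t.1 i + 1)).map fun k =>
    (Function.update t.1 i k, t.2 * ((Nat.choose (t.1 i) k : R) * β ^ (t.1 i - k)))

variable [DecidableEq R] in
/-- Translation of ONE variable `xᵢ ↦ xᵢ + β` on term lists (the identity when `β = 0`, else the
binomial expansion). [folklore] -/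
def transVar (i : Fin n) (β : R) (L : Terms n R) : Terms n R :=
  if β = 0 then L else expandVar i β L

variable [DecidableEq R] in
/-- Translation by the point `b` on term lists: one variable after the other. [folklore] -/
def transAll (b : Fin n → R) (L : Terms n R) : Terms n R :=
  (List.finRange n).foldr (fun i acc => transVar i (b i) acc) L

/-- The one-variable translation as an algebra map. [folklore] -/
def tau (i : Fin n) (β : R) : MvPolynomial (Fin n) R →ₐ[R] MvPolynomial (Fin n) R :=
  aeval (Function.update X i (X i + C β))

/-- `tau` fixes constants. [folklore] -/
theorem tau_C (i : Fin n) (β : R) (c : R) : tau i β (C c) = C c := by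
  rw [tau, aeval_C, algebraMap_eq]

/-- `tau` on a variable. [folklore] -/
theorem tau_X (i : Fin n) (β : R) (k : Fin n) :
    tau i β (X k) = if k = i then X i + C β else X k := by
  rw [tau, aeval_X, Function.update_apply]

/-- A monomial as constant times the product of powers over ALL variables. [folklore] -/
theorem monomial_expo_eq (e : Fin n → ℕ) (c : R) :
    monomial (expo e) c = C c * ∏ k, (X k : MvPolynomial (Fin n) R) ^ e k := by
  rw [monomial_eq, Finsupp.prod_fintype]
  · rfl
  · intro i; exact pow_zero _

/-- Splitting the product of powers at the variable `i`. [folklore] -/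
theorem prod_pow_eq_mul (e : Fin n → ℕ) (i : Fin n) :
    (∏ k, (X k : MvPolynomial (Fin n) R) ^ e k) = X i ^ e i * ∏ k ∈ univ.erase i, X k ^ e k := by
  rw [← Finset.mul_prod_erase univ _ (mem_univ i)]

/-- The monomial with the `i`-th exponent replaced. [folklore] -/
theorem monomial_update_eq (e : Fin n → ℕ) (i : Fin n) (k : ℕ) (c : R) :
    monomial (expo (Function.update e i k)) c =
      C c * (X i ^ k * ∏ k' ∈ univ.erase i, (X k' : MvPolynomial (Fin n) R) ^ e k') := by
  rw [monomial_expo_eq, prod_pow_eq_mul _ i, Function.update_self]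
  congr 2
  exact Finset.prod_congr rfl fun k' hk' => by rw [Function.update_of_ne (ne_of_mem_erase hk')]

/-- `List.range` sums are `Finset.range` sums. [folklore] -/
theorem list_sum_range_map {M : Type*} [AddCommMonoid M] (m : ℕ) (f : ℕ → M) :
    ((List.range m).map f).sum = ∑ k ∈ range m, f k := by
  induction m with
  | zero => simp
  | succ m ih => rw [List.range_succ, List.map_append, List.sum_append, ih, Finset.sum_range_succ]; simp

/-- **`tau` on a monomial** is the term list produced by the binomial theorem. [folklore] -/
theorem tau_monomial (i : Fin n) (β : R) (e : Fin n → ℕ) (c : R) :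
    tau i β (monomial (expo e) c) = evalT ((List.range (e i + 1)).map fun k =>
      (Function.update e i k, c * ((Nat.choose (e i) k : R) * β ^ (e i - k)))) := by
  rw [evalT_eq_sum, List.map_map, list_sum_range_map, monomial_expo_eq, prod_pow_eq_mul _ i, map_mul,
    tau_C, map_mul, map_pow, tau_X, if_pos rfl, map_prod]
  have hfix : (∏ k ∈ univ.erase i, (tau i β) ((X k : MvPolynomial (Fin n) R) ^ e k)) =
      ∏ k ∈ univ.erase i, (X k : MvPolynomial (Fin n) R) ^ e k :=
    Finset.prod_congr rfl fun k hk => by rw [map_pow, tau_X, if_neg (ne_of_mem_erase hk)]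
  rw [hfix, add_pow, Finset.sum_mul, Finset.mul_sum]
  refine Finset.sum_congr rfl fun k _ => ?_
  simp only [Function.comp_apply]
  rw [monomial_update_eq, map_mul, map_mul, map_natCast, map_pow]
  ring

/-- **`tau` on a presented polynomial** is the binomial expansion `expandVar`. [folklore] -/
theorem tau_evalT_expand (i : Fin n) (β : R) (L : Terms n R) : tau i β (evalT L) = evalT (expandVar i β L) := by
  induction L with
  | nil => simp [expandVar]
  | cons t L ih =>
    simp only [expandVar, List.flatMap_cons] at ih ⊢
    rw [evalT_cons, map_add, ih, tau_monomial, evalT_append]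

/-- `tau i 0` is the identity. [folklore] -/
theorem tau_zero_apply (i : Fin n) (F : MvPolynomial (Fin n) R) : tau i 0 F = F := by
  have : tau i (0 : R) = AlgHom.id R _ := by
    refine MvPolynomial.algHom_ext fun k => ?_
    rw [tau_X, AlgHom.id_apply]
    split_ifs with h
    · rw [h, map_zero, add_zero]
    · rfl
  rw [this, AlgHom.id_apply]

variable [DecidableEq R] in
/-- **`tau` on a presented polynomial** is `transVar`. [folklore] -/
theorem tau_evalT (i : Fin n) (β : R) (L : Terms n R) : tau i β (evalT L) = evalT (transVar i β L) := by
  unfold transVar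
  split_ifs with h
  · rw [h, tau_zero_apply]
  · exact tau_evalT_expand i β L

/-- The composite of the one-variable translations over a list of variables. [folklore] -/
def tauList (b : Fin n → R) : List (Fin n) → (MvPolynomial (Fin n) R →ₐ[R] MvPolynomial (Fin n) R)
  | [] => AlgHom.id R _
  | i :: l => (tau i (b i)).comp (tauList b l)

/-- `tauList` on a variable: shifted iff the variable is in the (duplicate-free) list. [folklore] -/
theorem tauList_X (b : Fin n → R) {l : List (Fin n)} (hl : l.Nodup) (k : Fin n) :
    tauList b l (X k) = if k ∈ l then X k + C (b k) else X k := by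
  induction l with
  | nil => simp [tauList]
  | cons i l ih =>
    rw [List.nodup_cons] at hl
    rw [tauList, AlgHom.comp_apply, ih hl.2]
    by_cases hk : k ∈ l
    · have hki : k ≠ i := fun h => hl.1 (h ▸ hk)
      rw [if_pos hk, map_add, tau_C, tau_X, if_neg hki, if_pos (List.mem_cons_of_mem i hk)]
    · rw [if_neg hk, tau_X]
      by_cases hki : k = i
      · subst hki; rw [if_pos rfl, if_pos (List.mem_cons_self)]
      · rw [if_neg hki, if_neg (by simp [hki, hk])]

variable [DecidableEq R] in
/-- `tauList` on a presented polynomial is the iterated `transVar`. [folklore] -/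
theorem tauList_evalT (b : Fin n → R) (l : List (Fin n)) (L : Terms n R) :
    tauList b l (evalT L) = evalT (l.foldr (fun i acc => transVar i (b i) acc) L) := by
  induction l with
  | nil => simp [tauList]
  | cons i l ih => rw [tauList, AlgHom.comp_apply, ih, tau_evalT, List.foldr_cons]

/-- The tree's translation is the composite of the one-variable translations. [folklore] -/
theorem translate_eq_tauList (b : Fin n → R) (F : MvPolynomial (Fin n) R) :
    PointBlowup.translate b F = tauList b (List.finRange n) F := by
  change aeval _ F = _
  have : (aeval fun i => (X i + C (b i) : MvPolynomial (Fin n) R)) = tauList b (List.finRange n) := by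
    refine MvPolynomial.algHom_ext fun k => ?_
    rw [aeval_X, tauList_X b (List.nodup_finRange n), if_pos (List.mem_finRange k)]
  rw [this]

variable [DecidableEq R] in
/-- **Transfer of the translation.** [folklore] -/
theorem translate_evalT (b : Fin n → R) (L : Terms n R) :
    PointBlowup.translate b (evalT L) = evalT (transAll b L) := by
  rw [translate_eq_tauList, tauList_evalT]; rfl

end StepKit

end Summit.ResolutionOfSingularities.ResolutionOfSingularities.Theorems.PIDim4

end
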